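import Summits.SmoothPoincare4.SmoothPoincare4.Theses.CylinderEntropy
import Summits.SmoothPoincare4.SmoothPoincare4.Theorems.CylinderEntropyCylinderRungTwoSurgeryTopology
import Summits.SmoothPoincare4.SmoothPoincare4.Theorems.CylinderEntropyCylinderRungTwoImmortalLeafRecognition
import Summits.SmoothPoincare4.SmoothPoincare4.Theorems.CylinderEntropyImmortalAreaToFloor
import Literature.Geometry.Riemannian.LowEntropyHypersurfacesFourNeckSurgery
import Literature.Topology.FourManifolds.HomotopyS4CompactProofs
import Literature.Topology.FourManifolds.HomotopyS4SimplyConnected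
import Literature.Topology.FourManifolds.SphereSimplyConnected
import HarnessLib

/-!
# Route `CylinderEntropy`, crux `CylinderRungTwo` (stmt-SmoothPoincare4-7631): THE ROUTE-LEVEL SPLIT
# `CylinderSurgeryResolution → NearSliceRecognition → CylinderRungTwo`

Planner file (crux-strategist, BC2-redirect re-examination of the deciding crux, 2026-08-17).  The recognition crux
R = `CylinderRungTwo` (a homotopy 4-sphere with a thin end-separating cross-section embedding into `N = S⁴ × ℝ`,
`λ_cyl < 4/e`, is `≅ S⁴`) is decomposed at route level into TWO typed pieces, stated over the route file's vocabulary
(Mathlib + Literature + the Theses-independent vocabulary file `…CylinderRungTwoKillingFluxDefs`: `IsCylinderMCF`,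
`SeparatesEnds`; the tree's `SphericalCylinderEntropy.cylEntropy`):

* X₁ = `CylinderSurgeryResolution` — **every thin cross-section is resolved by a mean curvature flow with neck surgery in
  `N`**: for EVERY compact connected smooth 4-manifold `M` (not only homotopy spheres) and every smooth end-separating
  embedding `ι : M → N` with `λ_cyl(ι M) < 4/e`, some slice `κ : M → ℝ⁶` lies in the least predicate closed under the six
  rules of the surgery tree (discard `S⁴` / `S³ × S¹` components; flow smoothly between two stopping times; reparametrise;
  cut a separating neck and cap both sides; cut a non-separating neck, double cap; declare immortal a thin end-separating
  smooth flow of a compact connected carrier).  The least-predicate phrasing is forced on the route file because the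
  inductive `CylNeckSurgeryResolvable` lives in a file importing the Theses module; `cylinderSurgeryResolution_iff` below
  certifies that X₁ is EXACTLY "`∀ …, ∃ κ, CylNeckSurgeryResolvable M κ`".  Content: the Chodosh–Mantoulidis–Schulze
  genericity theorem and Daniels-Holgate surgery re-run in `N` — the research piece; the line lead's registered
  `stub_cylinderSurgeryFlow` is its homotopy-sphere case (`stub_cylinderSurgeryFlow_of_cylinderSurgeryResolution`).  Unlike
  that case it is NOT a consequence of SPC4: it classifies the thin cross-sections of every topology.
* X₂ = `NearSliceRecognition` — **nearly calibrated simply connected cross-sections are standard**: there is `ε > 0` such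
  that every compact connected simply connected cross-section `ι : P → N` with `λ_cyl(ι P) < 1 + ε` is `≅ S⁴`.  PROVED
  modulo the published Chodosh–Mantoulidis–Schulze 2025 Cor. 1.5 (b) (`nearSliceRecognition_of_cor15b` = the landed
  `helper_simplyConnectedRecognition`: conformal domination with constant `1.47` and the mid-scale kernel certificates);
  it strengthens the route's rank-3 crux `SliceIsolation` (`sliceIsolation_of_nearSliceRecognition`).

ASSEMBLY `CylinderRungTwo_of_subs : X₁ → X₂ → CylinderRungTwo` (sorry-free; not a one-line seam): the homotopy sphere `M`
is compact, connected, simply connected; X₁ at the inductive predicate gives a resolved slice; immortal leaves of the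
surgery tree are recognised by X₂ together with the PROVED immortal half — item `ImmortalAreaToFloor`
(stmt-SmoothPoincare4-17197, `KillingFlux.areaToFloor`, p144604), Hamilton's monotonicity and the relaxation glue give a late
slice with `λ_cyl < 1 + ε`; Daniels-Holgate's backward induction over the tree (`helper_cylNeckSurgeryTopology`) and
Kervaire–Milnor give `M ≅ S⁴`.

Piece probes (planner folder `bc/`, recorded in the planner's NOTES): `X₁ → SmoothPoincare4`, `X₁ → CylinderRungTwo`,
`X₂ → SmoothPoincare4`, `X₂ → CylinderRungTwo` all FAIL under `first | exact? | simpa | aesop`, and neither piece is a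
consequence of the summit statement.

No `sorry`, no definition, no new named fact; every theorem is conditional exactly on its displayed hypotheses.

References: O. Chodosh, C. Mantoulidis, F. Schulze, Duke Math. J. 174 (2025), arXiv:2309.03856, Thm. 1.13, Cor. 1.5 (b);
J. M. Daniels-Holgate, Adv. Math. 410 (2022), Thm. 1.3 and proof of Thm. 6.4; M. Kervaire, J. Milnor, Ann. of Math. 77
(1963), Lemma 2.1; R. S. Hamilton, Comm. Anal. Geom. 1 (1993) 127–137, Thm. 4.1.
-/


noncomputable section

-- the prescribed namespace repeats a component
set_option linter.dupNamespace false

open MeasureTheory Set Function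
open scoped Manifold ContDiff ENNReal Topology BigOperators ContinuousMap

namespace Summit.SmoothPoincare4.SmoothPoincare4.Theorems.CylinderRungTwoSplit

open Literature.Geometry.Riemannian
open Literature.Geometry.Riemannian.SphericalCylinderEntropy (cylEntropy)
open Literature.Topology.FourManifolds
open Summit.SmoothPoincare4.SmoothPoincare4.Cruxes.CylinderRungTwo.KillingFlux
open Summit.SmoothPoincare4.SmoothPoincare4.Theses.CylinderEntropy (CylinderRungTwo SliceIsolation)

/-! ### The least-predicate (impredicative) phrasing of the surgery tree IS the inductive predicate -/

/-- **A slice in the least predicate closed under the six surgery rules is `CylNeckSurgeryResolvable`**: instantiate the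
predicate variable at the inductive predicate, whose constructors are the six rules (the `flow` rule's eight clauses are
the fields of `IsCylinderMCFOn`). [folklore] -/
theorem resolvable_of_leastPredicate {M : Type} [TopologicalSpace M] [ChartedSpace (EuclideanSpace ℝ (Fin 4)) M] {κ : M → EuclideanSpace ℝ (Fin 6)}
    (h : haveI : (Literature.Geometry.Riemannian.euclideanMetric (EuclideanSpace ℝ (Fin 6))).HasLeviCivita := Literature.Geometry.Riemannian.instHasLeviCivitaEuclideanMetric; haveI : Fact (Module.finrank ℝ (EuclideanSpace ℝ (Fin 4)) = 3 + 1) := ⟨finrank_euclideanSpace_fin⟩; ∀ Q : (∀ (P : Type) [TopologicalSpace P] [ChartedSpace (EuclideanSpace ℝ (Fin 4)) P], (P → EuclideanSpace ℝ (Fin 6)) → Prop), (∀ (P : Type) [TopologicalSpace P] [ChartedSpace (EuclideanSpace ℝ (Fin 4)) P], Literature.Geometry.Riemannian.IsMCFDiscardedComponent P → ∀ κ' : P → EuclideanSpace ℝ (Fin 6), Q P κ') → (∀ (P : Type) [TopologicalSpace P] [T2Space P] [ChartedSpace (EuclideanSpace ℝ (Fin 4)) P] [IsManifold (𝓡 4)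 ∞ P] (F ν : ℝ → P → EuclideanSpace ℝ (Fin 6)) (T₀ T₁ : ℝ), T₀ < T₁ → (∃ U : Set ℝ, IsOpen U ∧ Set.Icc T₀ T₁ ⊆ U ∧ ContMDiffOn (𝓘(ℝ, ℝ).prod (𝓡 4)) (𝓡 6) ∞ (fun q : ℝ × P => F q.1 q.2) (U ×ˢ Set.univ)) → (∀ t ∈ Set.Icc T₀ T₁, Manifold.IsSmoothEmbedding (𝓡 4) (𝓡 6) ∞ (F t)) → (∀ t ∈ Set.Icc T₀ T₁, ∀ x, ∑ i : Fin 5, F t x (Fin.castSucc i) ^ 2 = 1) → ∀ himm : (∀ t ∈ Set.Icc T₀ T₁, (Literature.Geometry.Riemannian.euclideanMetric (EuclideanSpace ℝ (Fin 6))).IsSpacelikeImmersion (𝓡 4) (F t)), (∀ t ∈ Set.Icc T₀ T₁, (Literature.Geometry.Riemannian.euclideanMetric (EuclideanSpace ℝ (Fin 6))).IsUnitNormal (𝓡 4) (F t) (ν t) 1) → (∀ t ∈ Set.Icc T₀ T₁, ∀ x, ∑ i : Fin 5, ν t x (Fin.castSucc i) * F t x (Fin.castSucc i) = 0) → (∀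 t ∈ Set.Icc T₀ T₁, ContMDiff (𝓡 4) (𝓡 6) ∞ (ν t)) → (∀ t (ht : t ∈ Set.Icc T₀ T₁) (x : P), mfderiv 𝓘(ℝ, ℝ) (𝓡 6) (fun s => F s x) t (1 : ℝ) = -((Literature.Geometry.Riemannian.euclideanMetric (EuclideanSpace ℝ (Fin 6))).meanCurvature (F t) Literature.Geometry.Lorentzian.PseudoRiemannianMetric.contMDiff_pullbackBilin_holds (himm t ht) (ν t) x) • ν t x) → Q P (F T₁) → Q P (F T₀)) → (∀ (P P' : Type) [TopologicalSpace P] [ChartedSpace (EuclideanSpace ℝ (Fin 4)) P] [TopologicalSpace P'] [ChartedSpace (EuclideanSpace ℝ (Fin 4)) P'] [IsManifold (𝓡 4) ∞ P'] (κ' : P → EuclideanSpace ℝ (Fin 6)) (e : P ≃ₘ⟮𝓡 4, 𝓡 4⟯ P'), Q P κ' → Q P' (κ' ∘ e.symm)) → (∀ (P : Type) [TopologicalSpace P] [T2Space P] [ChartedSpace (EuclideanSpace ℝ (Fin 4)) P] [IsManifold (𝓡 4) ∞ P] (κ' : P → EuclideanSpace ℝ (Fin 6)) (ψ : (Metric.sphere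 (0 : EuclideanSpace ℝ (Fin 4)) 1) × ℝ → P) (D₁ : Literature.Topology.FourManifolds.NeckCapData 3 ψ) (D₂ : Literature.Topology.FourManifolds.NeckCapData 3 (fun q : (Metric.sphere (0 : EuclideanSpace ℝ (Fin 4)) 1) × ℝ => ψ (q.1, -q.2))), Disjoint (D₁.side : Set P) D₂.side → (∀ p : P, p ∉ D₁.side → p ∉ D₂.side → ∃ θ : Metric.sphere (0 : EuclideanSpace ℝ (Fin 4)) 1, ψ (θ, 0) = p) → ∀ (κ₁ : D₁.Capped → EuclideanSpace ℝ (Fin 6)) (κ₂ : D₂.Capped → EuclideanSpace ℝ (Fin 6)), Q D₁.Capped κ₁ → Q D₂.Capped κ₂ → Q P κ') → (∀ (P : Type) [TopologicalSpace P] [T2Space P] [ChartedSpace (EuclideanSpace ℝ (Fin 4)) P] [IsManifold (𝓡 4) ∞ P] (κ' : P → EuclideanSpace ℝ (Fin 6)) (ψ : (Metric.sphere (0 : EuclideanSpace ℝ (Fin 4)) 1) × ℝ → P) (hψ : Manifold.IsSmoothEmbedding ((𝓡 3).prod 𝓘(ℝ, ℝ)) (𝓡 4) ∞ ψ) (hψo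 : IsOpen (Set.range ψ)), IsPreconnected (ψ '' (Set.univ ×ˢ ({0} : Set ℝ)))ᶜ → ∀ κ'' : Literature.Topology.FourManifolds.DoubleCap.M hψ hψo → EuclideanSpace ℝ (Fin 6), Q (Literature.Topology.FourManifolds.DoubleCap.M hψ hψo) κ'' → Q P κ') → (∀ (P : Type) [TopologicalSpace P] [T2Space P] [SecondCountableTopology P] [ChartedSpace (EuclideanSpace ℝ (Fin 4)) P] [IsManifold (𝓡 4) ∞ P] [CompactSpace P] [ConnectedSpace P] (F ν : ℝ → P → EuclideanSpace ℝ (Fin 6)) (T : ℝ), Summit.SmoothPoincare4.SmoothPoincare4.Cruxes.CylinderRungTwo.KillingFlux.IsCylinderMCF P F ν T → (∀ t, T ≤ t → Summit.SmoothPoincare4.SmoothPoincare4.Cruxes.CylinderRungTwo.KillingFlux.SeparatesEnds (Set.range (F t))) → (∀ t, T ≤ t → Literature.Geometry.Riemannian.SphericalCylinderEntropy.cylEntropy (Set.range (F t)) < 2) → Q P (F T)) → Q M κ) :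
    CylNeckSurgeryResolvable M κ :=
  h (fun P _ _ κ' => CylNeckSurgeryResolvable P κ')
    (fun _ _ _ hM κ' => CylNeckSurgeryResolvable.discard hM κ')
    (fun _ _ _ _ _ _ _ _ _ hT hU hemb hmem himm hun htan hνs hvel hQ =>
      CylNeckSurgeryResolvable.flow hT ⟨hU, hemb, hmem, himm, hun, htan, hνs, hvel⟩ hQ)
    (fun _ _ _ _ _ _ _ _ e hQ => CylNeckSurgeryResolvable.of_diffeomorph hQ e)
    (fun _ _ _ _ _ κ' _ D₁ D₂ hdisj hcover κ₁ κ₂ h₁ h₂ => CylNeckSurgeryResolvable.cut κ' D₁ D₂ hdisj hcover κ₁ κ₂ h₁ h₂)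
    (fun _ _ _ _ _ κ' _ hψ hψo hns κ'' hQ => CylNeckSurgeryResolvable.cutNonseparating κ' hψ hψo hns κ'' hQ)
    (fun _ _ _ _ _ _ _ _ _ _ _ hF hsep hthin => CylNeckSurgeryResolvable.immortal hF hsep hthin)

/-- **Conversely, a `CylNeckSurgeryResolvable` slice lies in every predicate closed under the six rules** (induction over the
tree). [folklore] -/
theorem leastPredicate_of_resolvable {M : Type} [TopologicalSpace M] [ChartedSpace (EuclideanSpace ℝ (Fin 4)) M] {κ : M → EuclideanSpace ℝ (Fin 6)}
    (h : CylNeckSurgeryResolvable M κ) :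
    haveI : (Literature.Geometry.Riemannian.euclideanMetric (EuclideanSpace ℝ (Fin 6))).HasLeviCivita := Literature.Geometry.Riemannian.instHasLeviCivitaEuclideanMetric; haveI : Fact (Module.finrank ℝ (EuclideanSpace ℝ (Fin 4)) = 3 + 1) := ⟨finrank_euclideanSpace_fin⟩; ∀ Q : (∀ (P : Type) [TopologicalSpace P] [ChartedSpace (EuclideanSpace ℝ (Fin 4)) P], (P → EuclideanSpace ℝ (Fin 6)) → Prop), (∀ (P : Type) [TopologicalSpace P] [ChartedSpace (EuclideanSpace ℝ (Fin 4)) P], Literature.Geometry.Riemannian.IsMCFDiscardedComponent P → ∀ κ' : P → EuclideanSpace ℝ (Fin 6), Q P κ') → (∀ (P : Type) [TopologicalSpace P] [T2Space P] [ChartedSpace (EuclideanSpace ℝ (Fin 4)) P] [IsManifold (𝓡 4) ∞ P] (F ν : ℝ → P → EuclideanSpace ℝ (Fin 6)) (T₀ T₁ : ℝ), T₀ < T₁ → (∃ U : Set ℝ, IsOpen U ∧ Set.Icc T₀ T₁ ⊆ U ∧ ContMDiffOn (𝓘(ℝ, ℝ).prod (𝓡 4)) (𝓡 6) ∞ (fun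 q : ℝ × P => F q.1 q.2) (U ×ˢ Set.univ)) → (∀ t ∈ Set.Icc T₀ T₁, Manifold.IsSmoothEmbedding (𝓡 4) (𝓡 6) ∞ (F t)) → (∀ t ∈ Set.Icc T₀ T₁, ∀ x, ∑ i : Fin 5, F t x (Fin.castSucc i) ^ 2 = 1) → ∀ himm : (∀ t ∈ Set.Icc T₀ T₁, (Literature.Geometry.Riemannian.euclideanMetric (EuclideanSpace ℝ (Fin 6))).IsSpacelikeImmersion (𝓡 4) (F t)), (∀ t ∈ Set.Icc T₀ T₁, (Literature.Geometry.Riemannian.euclideanMetric (EuclideanSpace ℝ (Fin 6))).IsUnitNormal (𝓡 4) (F t) (ν t) 1) → (∀ t ∈ Set.Icc T₀ T₁, ∀ x, ∑ i : Fin 5, ν t x (Fin.castSucc i) * F t x (Fin.castSucc i) = 0) → (∀ t ∈ Set.Icc T₀ T₁, ContMDiff (𝓡 4) (𝓡 6) ∞ (ν t)) → (∀ t (ht : t ∈ Set.Icc T₀ T₁) (x : P), mfderiv 𝓘(ℝ, ℝ) (𝓡 6) (fun s => F s x) t (1 : ℝ) = -((Literature.Geometry.Riemannian.euclideanMetric (EuclideanSpace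 ℝ (Fin 6))).meanCurvature (F t) Literature.Geometry.Lorentzian.PseudoRiemannianMetric.contMDiff_pullbackBilin_holds (himm t ht) (ν t) x) • ν t x) → Q P (F T₁) → Q P (F T₀)) → (∀ (P P' : Type) [TopologicalSpace P] [ChartedSpace (EuclideanSpace ℝ (Fin 4)) P] [TopologicalSpace P'] [ChartedSpace (EuclideanSpace ℝ (Fin 4)) P'] [IsManifold (𝓡 4) ∞ P'] (κ' : P → EuclideanSpace ℝ (Fin 6)) (e : P ≃ₘ⟮𝓡 4, 𝓡 4⟯ P'), Q P κ' → Q P' (κ' ∘ e.symm)) → (∀ (P : Type) [TopologicalSpace P] [T2Space P] [ChartedSpace (EuclideanSpace ℝ (Fin 4)) P] [IsManifold (𝓡 4) ∞ P] (κ' : P → EuclideanSpace ℝ (Fin 6)) (ψ : (Metric.sphere (0 : EuclideanSpace ℝ (Fin 4)) 1) × ℝ → P) (D₁ : Literature.Topology.FourManifolds.NeckCapData 3 ψ) (D₂ : Literature.Topology.FourManifolds.NeckCapData 3 (fun q : (Metric.sphere (0 : EuclideanSpace ℝ (Fin 4)) 1) × ℝ => ψ (q.1, -q.2))), Disjoint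 (D₁.side : Set P) D₂.side → (∀ p : P, p ∉ D₁.side → p ∉ D₂.side → ∃ θ : Metric.sphere (0 : EuclideanSpace ℝ (Fin 4)) 1, ψ (θ, 0) = p) → ∀ (κ₁ : D₁.Capped → EuclideanSpace ℝ (Fin 6)) (κ₂ : D₂.Capped → EuclideanSpace ℝ (Fin 6)), Q D₁.Capped κ₁ → Q D₂.Capped κ₂ → Q P κ') → (∀ (P : Type) [TopologicalSpace P] [T2Space P] [ChartedSpace (EuclideanSpace ℝ (Fin 4)) P] [IsManifold (𝓡 4) ∞ P] (κ' : P → EuclideanSpace ℝ (Fin 6)) (ψ : (Metric.sphere (0 : EuclideanSpace ℝ (Fin 4)) 1) × ℝ → P) (hψ : Manifold.IsSmoothEmbedding ((𝓡 3).prod 𝓘(ℝ, ℝ)) (𝓡 4) ∞ ψ) (hψo : IsOpen (Set.range ψ)), IsPreconnected (ψ '' (Set.univ ×ˢ ({0} : Set ℝ)))ᶜ → ∀ κ'' : Literature.Topology.FourManifolds.DoubleCap.M hψ hψo → EuclideanSpace ℝ (Fin 6), Q (Literature.Topology.FourManifolds.DoubleCap.M hψ hψo) κ'' → Q P κ') →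 (∀ (P : Type) [TopologicalSpace P] [T2Space P] [SecondCountableTopology P] [ChartedSpace (EuclideanSpace ℝ (Fin 4)) P] [IsManifold (𝓡 4) ∞ P] [CompactSpace P] [ConnectedSpace P] (F ν : ℝ → P → EuclideanSpace ℝ (Fin 6)) (T : ℝ), Summit.SmoothPoincare4.SmoothPoincare4.Cruxes.CylinderRungTwo.KillingFlux.IsCylinderMCF P F ν T → (∀ t, T ≤ t → Summit.SmoothPoincare4.SmoothPoincare4.Cruxes.CylinderRungTwo.KillingFlux.SeparatesEnds (Set.range (F t))) → (∀ t, T ≤ t → Literature.Geometry.Riemannian.SphericalCylinderEntropy.cylEntropy (Set.range (F t)) < 2) → Q P (F T)) → Q M κ := by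
  intro Q h1 h2 h3 h4 h5 h6
  induction h with
  | discard hM κ => exact h1 _ hM κ
  | flow hT hF h ih =>
    exact h2 _ _ _ _ _ hT hF.contMDiffOn hF.isSmoothEmbedding hF.mem_cyl hF.isSpacelikeImmersion hF.isUnitNormal
      hF.normal_tangent hF.contMDiff_normal hF.velocity_eq ih
  | of_diffeomorph h e ih => exact h3 _ _ _ e ih
  | cut κ D₁ D₂ hdisj hcover κ₁ κ₂ h₁ h₂ ih₁ ih₂ => exact h4 _ κ _ D₁ D₂ hdisj hcover κ₁ κ₂ ih₁ ih₂
  | cutNonseparating κ hψ hψo hns κ' h ih => exact h5 _ κ _ hψ hψo hns κ' ih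
  | immortal hF hsep hthin => exact h6 _ _ _ _ hF hsep hthin

/-- **The route piece `CylinderSurgeryResolution` (least-predicate phrasing, verbatim the route decl) is equivalent to
"every thin cross-section of a compact connected 4-manifold has a `CylNeckSurgeryResolvable` slice".** [folklore] -/
theorem cylinderSurgeryResolution_iff :
    (haveI : (Literature.Geometry.Riemannian.euclideanMetric (EuclideanSpace ℝ (Fin 6))).HasLeviCivita := Literature.Geometry.Riemannian.instHasLeviCivitaEuclideanMetric; haveI : Fact (Module.finrank ℝ (EuclideanSpace ℝ (Fin 4)) = 3 + 1) := ⟨finrank_euclideanSpace_fin⟩; ∀ (M : Type) [TopologicalSpace M] [T2Space M] [SecondCountableTopology M] [ChartedSpace (EuclideanSpace ℝ (Fin 4)) M] [IsManifold (𝓡 4) ∞ M] [CompactSpace M] [ConnectedSpace M] (ι : M → EuclideanSpace ℝ (Fin 6)), Manifold.IsSmoothEmbedding (𝓡 4) (𝓡 6) ∞ ι → (∀ x, ∑ i : Fin 5, ι x (Fin.castSucc i) ^ 2 = 1) → Summit.SmoothPoincare4.SmoothPoincare4.Cruxes.CylinderRungTwo.KillingFlux.SeparatesEnds (Set.range ι)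 → Literature.Geometry.Riemannian.SphericalCylinderEntropy.cylEntropy (Set.range ι) < ENNReal.ofReal (4 / Real.exp 1) → ∃ κ : M → EuclideanSpace ℝ (Fin 6), ∀ Q : (∀ (P : Type) [TopologicalSpace P] [ChartedSpace (EuclideanSpace ℝ (Fin 4)) P], (P → EuclideanSpace ℝ (Fin 6)) → Prop), (∀ (P : Type) [TopologicalSpace P] [ChartedSpace (EuclideanSpace ℝ (Fin 4)) P], Literature.Geometry.Riemannian.IsMCFDiscardedComponent P → ∀ κ' : P → EuclideanSpace ℝ (Fin 6), Q P κ') → (∀ (P : Type) [TopologicalSpace P] [T2Space P] [ChartedSpace (EuclideanSpace ℝ (Fin 4)) P] [IsManifold (𝓡 4) ∞ P] (F ν : ℝ → P → EuclideanSpace ℝ (Fin 6)) (T₀ T₁ : ℝ), T₀ < T₁ → (∃ U : Set ℝ, IsOpen U ∧ Set.Icc T₀ T₁ ⊆ U ∧ ContMDiffOn (𝓘(ℝ, ℝ).prod (𝓡 4)) (𝓡 6) ∞ (fun q : ℝ × P => F q.1 q.2) (U ×ˢ Set.univ)) → (∀ t ∈ Set.Icc T₀ T₁, Manifold.IsSmoothEmbedding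 (𝓡 4) (𝓡 6) ∞ (F t)) → (∀ t ∈ Set.Icc T₀ T₁, ∀ x, ∑ i : Fin 5, F t x (Fin.castSucc i) ^ 2 = 1) → ∀ himm : (∀ t ∈ Set.Icc T₀ T₁, (Literature.Geometry.Riemannian.euclideanMetric (EuclideanSpace ℝ (Fin 6))).IsSpacelikeImmersion (𝓡 4) (F t)), (∀ t ∈ Set.Icc T₀ T₁, (Literature.Geometry.Riemannian.euclideanMetric (EuclideanSpace ℝ (Fin 6))).IsUnitNormal (𝓡 4) (F t) (ν t) 1) → (∀ t ∈ Set.Icc T₀ T₁, ∀ x, ∑ i : Fin 5, ν t x (Fin.castSucc i) * F t x (Fin.castSucc i) = 0) → (∀ t ∈ Set.Icc T₀ T₁, ContMDiff (𝓡 4) (𝓡 6) ∞ (ν t)) → (∀ t (ht : t ∈ Set.Icc T₀ T₁) (x : P), mfderiv 𝓘(ℝ, ℝ) (𝓡 6) (fun s => F s x) t (1 : ℝ) = -((Literature.Geometry.Riemannian.euclideanMetric (EuclideanSpace ℝ (Fin 6))).meanCurvature (F t) Literature.Geometry.Lorentzian.PseudoRiemannianMetric.contMDiff_pullbackBilin_holds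 (himm t ht) (ν t) x) • ν t x) → Q P (F T₁) → Q P (F T₀)) → (∀ (P P' : Type) [TopologicalSpace P] [ChartedSpace (EuclideanSpace ℝ (Fin 4)) P] [TopologicalSpace P'] [ChartedSpace (EuclideanSpace ℝ (Fin 4)) P'] [IsManifold (𝓡 4) ∞ P'] (κ' : P → EuclideanSpace ℝ (Fin 6)) (e : P ≃ₘ⟮𝓡 4, 𝓡 4⟯ P'), Q P κ' → Q P' (κ' ∘ e.symm)) → (∀ (P : Type) [TopologicalSpace P] [T2Space P] [ChartedSpace (EuclideanSpace ℝ (Fin 4)) P] [IsManifold (𝓡 4) ∞ P] (κ' : P → EuclideanSpace ℝ (Fin 6)) (ψ : (Metric.sphere (0 : EuclideanSpace ℝ (Fin 4)) 1) × ℝ → P) (D₁ : Literature.Topology.FourManifolds.NeckCapData 3 ψ) (D₂ : Literature.Topology.FourManifolds.NeckCapData 3 (fun q : (Metric.sphere (0 : EuclideanSpace ℝ (Fin 4)) 1) × ℝ => ψ (q.1, -q.2))), Disjoint (D₁.side : Set P) D₂.side → (∀ p : P, p ∉ D₁.side → p ∉ D₂.side → ∃ θ : Metric.sphere (0 : EuclideanSpace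 ℝ (Fin 4)) 1, ψ (θ, 0) = p) → ∀ (κ₁ : D₁.Capped → EuclideanSpace ℝ (Fin 6)) (κ₂ : D₂.Capped → EuclideanSpace ℝ (Fin 6)), Q D₁.Capped κ₁ → Q D₂.Capped κ₂ → Q P κ') → (∀ (P : Type) [TopologicalSpace P] [T2Space P] [ChartedSpace (EuclideanSpace ℝ (Fin 4)) P] [IsManifold (𝓡 4) ∞ P] (κ' : P → EuclideanSpace ℝ (Fin 6)) (ψ : (Metric.sphere (0 : EuclideanSpace ℝ (Fin 4)) 1) × ℝ → P) (hψ : Manifold.IsSmoothEmbedding ((𝓡 3).prod 𝓘(ℝ, ℝ)) (𝓡 4) ∞ ψ) (hψo : IsOpen (Set.range ψ)), IsPreconnected (ψ '' (Set.univ ×ˢ ({0} : Set ℝ)))ᶜ → ∀ κ'' : Literature.Topology.FourManifolds.DoubleCap.M hψ hψo → EuclideanSpace ℝ (Fin 6), Q (Literature.Topology.FourManifolds.DoubleCap.M hψ hψo) κ'' → Q P κ') → (∀ (P : Type) [TopologicalSpace P] [T2Space P] [SecondCountableTopology P] [ChartedSpace (EuclideanSpace ℝ (Fin 4)) P] [IsManifold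 (𝓡 4) ∞ P] [CompactSpace P] [ConnectedSpace P] (F ν : ℝ → P → EuclideanSpace ℝ (Fin 6)) (T : ℝ), Summit.SmoothPoincare4.SmoothPoincare4.Cruxes.CylinderRungTwo.KillingFlux.IsCylinderMCF P F ν T → (∀ t, T ≤ t → Summit.SmoothPoincare4.SmoothPoincare4.Cruxes.CylinderRungTwo.KillingFlux.SeparatesEnds (Set.range (F t))) → (∀ t, T ≤ t → Literature.Geometry.Riemannian.SphericalCylinderEntropy.cylEntropy (Set.range (F t)) < 2) → Q P (F T)) → Q M κ) ↔
    (∀ (M : Type) [TopologicalSpace M] [T2Space M] [SecondCountableTopology M] [ChartedSpace (EuclideanSpace ℝ (Fin 4)) M] [IsManifold (𝓡 4) ∞ M] [CompactSpace M] [ConnectedSpace M] (ι : M → EuclideanSpace ℝ (Fin 6)), Manifold.IsSmoothEmbedding (𝓡 4) (𝓡 6) ∞ ι → (∀ x, ∑ i : Fin 5, ι x (Fin.castSucc i) ^ 2 = 1) → Summit.SmoothPoincare4.SmoothPoincare4.Cruxes.CylinderRungTwo.KillingFlux.SeparatesEnds (Set.range ι) → Literature.Geometry.Riemannian.SphericalCylinderEntropy.cylEntropy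 (Set.range ι) < ENNReal.ofReal (4 / Real.exp 1) → ∃ κ : M → EuclideanSpace ℝ (Fin 6), Summit.SmoothPoincare4.SmoothPoincare4.Cruxes.CylinderRungTwo.KillingFlux.CylNeckSurgeryResolvable M κ) :=
  ⟨fun h M _ _ _ _ _ _ _ ι hι hN hsep hent =>
      let ⟨κ, hκ⟩ := h M ι hι hN hsep hent
      ⟨κ, resolvable_of_leastPredicate hκ⟩,
    fun h M _ _ _ _ _ _ _ ι hι hN hsep hent =>
      let ⟨κ, hκ⟩ := h M ι hι hN hsep hent
      ⟨κ, leastPredicate_of_resolvable hκ⟩⟩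

/-- **The route piece implies the line lead's registered research stub `stub_cylinderSurgeryFlow`** (line `killing-flux`,
reshape r15; its homotopy-sphere case): a homotopy 4-sphere is compact and connected. [folklore] -/
theorem stub_cylinderSurgeryFlow_of_cylinderSurgeryResolution
    (hX₁ : haveI : (Literature.Geometry.Riemannian.euclideanMetric (EuclideanSpace ℝ (Fin 6))).HasLeviCivita := Literature.Geometry.Riemannian.instHasLeviCivitaEuclideanMetric; haveI : Fact (Module.finrank ℝ (EuclideanSpace ℝ (Fin 4)) = 3 + 1) := ⟨finrank_euclideanSpace_fin⟩; ∀ (M : Type) [TopologicalSpace M] [T2Space M] [SecondCountableTopology M] [ChartedSpace (EuclideanSpace ℝ (Fin 4)) M] [IsManifold (𝓡 4) ∞ M] [CompactSpace M] [ConnectedSpace M] (ι : M → EuclideanSpace ℝ (Fin 6)), Manifold.IsSmoothEmbedding (𝓡 4) (𝓡 6) ∞ ι → (∀ x, ∑ i : Fin 5, ι x (Fin.castSucc i) ^ 2 = 1) → Summit.SmoothPoincare4.SmoothPoincare4.Cruxes.CylinderRungTwo.KillingFlux.SeparatesEnds (Set.range ι) → Literature.Geometry.Riemannian.SphericalCylinderEntropy.cylEntropy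 (Set.range ι) < ENNReal.ofReal (4 / Real.exp 1) → ∃ κ : M → EuclideanSpace ℝ (Fin 6), ∀ Q : (∀ (P : Type) [TopologicalSpace P] [ChartedSpace (EuclideanSpace ℝ (Fin 4)) P], (P → EuclideanSpace ℝ (Fin 6)) → Prop), (∀ (P : Type) [TopologicalSpace P] [ChartedSpace (EuclideanSpace ℝ (Fin 4)) P], Literature.Geometry.Riemannian.IsMCFDiscardedComponent P → ∀ κ' : P → EuclideanSpace ℝ (Fin 6), Q P κ') → (∀ (P : Type) [TopologicalSpace P] [T2Space P] [ChartedSpace (EuclideanSpace ℝ (Fin 4)) P] [IsManifold (𝓡 4) ∞ P] (F ν : ℝ → P → EuclideanSpace ℝ (Fin 6)) (T₀ T₁ : ℝ), T₀ < T₁ → (∃ U : Set ℝ, IsOpen U ∧ Set.Icc T₀ T₁ ⊆ U ∧ ContMDiffOn (𝓘(ℝ, ℝ).prod (𝓡 4)) (𝓡 6) ∞ (fun q : ℝ × P => F q.1 q.2) (U ×ˢ Set.univ)) → (∀ t ∈ Set.Icc T₀ T₁, Manifold.IsSmoothEmbedding (𝓡 4) (𝓡 6) ∞ (F t)) → (∀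 t ∈ Set.Icc T₀ T₁, ∀ x, ∑ i : Fin 5, F t x (Fin.castSucc i) ^ 2 = 1) → ∀ himm : (∀ t ∈ Set.Icc T₀ T₁, (Literature.Geometry.Riemannian.euclideanMetric (EuclideanSpace ℝ (Fin 6))).IsSpacelikeImmersion (𝓡 4) (F t)), (∀ t ∈ Set.Icc T₀ T₁, (Literature.Geometry.Riemannian.euclideanMetric (EuclideanSpace ℝ (Fin 6))).IsUnitNormal (𝓡 4) (F t) (ν t) 1) → (∀ t ∈ Set.Icc T₀ T₁, ∀ x, ∑ i : Fin 5, ν t x (Fin.castSucc i) * F t x (Fin.castSucc i) = 0) → (∀ t ∈ Set.Icc T₀ T₁, ContMDiff (𝓡 4) (𝓡 6) ∞ (ν t)) → (∀ t (ht : t ∈ Set.Icc T₀ T₁) (x : P), mfderiv 𝓘(ℝ, ℝ) (𝓡 6) (fun s => F s x) t (1 : ℝ) = -((Literature.Geometry.Riemannian.euclideanMetric (EuclideanSpace ℝ (Fin 6))).meanCurvature (F t) Literature.Geometry.Lorentzian.PseudoRiemannianMetric.contMDiff_pullbackBilin_holds (himm t ht) (ν t) x) • ν t x) → Q P (F T₁)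 → Q P (F T₀)) → (∀ (P P' : Type) [TopologicalSpace P] [ChartedSpace (EuclideanSpace ℝ (Fin 4)) P] [TopologicalSpace P'] [ChartedSpace (EuclideanSpace ℝ (Fin 4)) P'] [IsManifold (𝓡 4) ∞ P'] (κ' : P → EuclideanSpace ℝ (Fin 6)) (e : P ≃ₘ⟮𝓡 4, 𝓡 4⟯ P'), Q P κ' → Q P' (κ' ∘ e.symm)) → (∀ (P : Type) [TopologicalSpace P] [T2Space P] [ChartedSpace (EuclideanSpace ℝ (Fin 4)) P] [IsManifold (𝓡 4) ∞ P] (κ' : P → EuclideanSpace ℝ (Fin 6)) (ψ : (Metric.sphere (0 : EuclideanSpace ℝ (Fin 4)) 1) × ℝ → P) (D₁ : Literature.Topology.FourManifolds.NeckCapData 3 ψ) (D₂ : Literature.Topology.FourManifolds.NeckCapData 3 (fun q : (Metric.sphere (0 : EuclideanSpace ℝ (Fin 4)) 1) × ℝ => ψ (q.1, -q.2))), Disjoint (D₁.side : Set P) D₂.side → (∀ p : P, p ∉ D₁.side → p ∉ D₂.side → ∃ θ : Metric.sphere (0 : EuclideanSpace ℝ (Fin 4)) 1, ψ (θ, 0)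 = p) → ∀ (κ₁ : D₁.Capped → EuclideanSpace ℝ (Fin 6)) (κ₂ : D₂.Capped → EuclideanSpace ℝ (Fin 6)), Q D₁.Capped κ₁ → Q D₂.Capped κ₂ → Q P κ') → (∀ (P : Type) [TopologicalSpace P] [T2Space P] [ChartedSpace (EuclideanSpace ℝ (Fin 4)) P] [IsManifold (𝓡 4) ∞ P] (κ' : P → EuclideanSpace ℝ (Fin 6)) (ψ : (Metric.sphere (0 : EuclideanSpace ℝ (Fin 4)) 1) × ℝ → P) (hψ : Manifold.IsSmoothEmbedding ((𝓡 3).prod 𝓘(ℝ, ℝ)) (𝓡 4) ∞ ψ) (hψo : IsOpen (Set.range ψ)), IsPreconnected (ψ '' (Set.univ ×ˢ ({0} : Set ℝ)))ᶜ → ∀ κ'' : Literature.Topology.FourManifolds.DoubleCap.M hψ hψo → EuclideanSpace ℝ (Fin 6), Q (Literature.Topology.FourManifolds.DoubleCap.M hψ hψo) κ'' → Q P κ') → (∀ (P : Type) [TopologicalSpace P] [T2Space P] [SecondCountableTopology P] [ChartedSpace (EuclideanSpace ℝ (Fin 4)) P] [IsManifold (𝓡 4) ∞ P] [CompactSpace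 P] [ConnectedSpace P] (F ν : ℝ → P → EuclideanSpace ℝ (Fin 6)) (T : ℝ), Summit.SmoothPoincare4.SmoothPoincare4.Cruxes.CylinderRungTwo.KillingFlux.IsCylinderMCF P F ν T → (∀ t, T ≤ t → Summit.SmoothPoincare4.SmoothPoincare4.Cruxes.CylinderRungTwo.KillingFlux.SeparatesEnds (Set.range (F t))) → (∀ t, T ≤ t → Literature.Geometry.Riemannian.SphericalCylinderEntropy.cylEntropy (Set.range (F t)) < 2) → Q P (F T)) → Q M κ) :
    ∀ (M : Type) [TopologicalSpace M] [T2Space M] [SecondCountableTopology M] [ChartedSpace (EuclideanSpace ℝ (Fin 4)) M] [IsManifold (𝓡 4) ∞ M], M ≃ₕ Metric.sphere (0 : EuclideanSpace ℝ (Fin 5)) 1 → ∀ ι : M → EuclideanSpace ℝ (Fin 6), Manifold.IsSmoothEmbedding (𝓡 4) (𝓡 6) ∞ ι → (∀ x, ∑ i : Fin 5, ι x (Fin.castSucc i) ^ 2 = 1) → Summit.SmoothPoincare4.SmoothPoincare4.Cruxes.CylinderRungTwo.KillingFlux.SeparatesEnds (Set.range ι) → Literature.Geometry.Riemannian.SphericalCylinderEntropy.cylEntropy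 (Set.range ι) < ENNReal.ofReal (4 / Real.exp 1) → ∃ κ : M → EuclideanSpace ℝ (Fin 6), Summit.SmoothPoincare4.SmoothPoincare4.Cruxes.CylinderRungTwo.KillingFlux.CylNeckSurgeryResolvable M κ := by
  intro M _ _ _ _ _ e ι hι hN hsep hent
  haveI : CompactSpace M := compactSpace_of_homotopyEquiv_sphere_four_holds M e
  haveI : PathConnectedSpace M := by
    haveI := pathConnectedSpace_sphere_four
    exact pathConnectedSpace_of_homotopyEquiv e
  obtain ⟨κ, hκ⟩ := hX₁ M ι hι hN hsep hent
  exact ⟨κ, resolvable_of_leastPredicate hκ⟩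

/-! ### The recognition piece -/

/-- **`NearSliceRecognition` (verbatim the route decl) from Chodosh–Mantoulidis–Schulze 2025 Cor. 1.5 (b) and the mid-scale
kernel certificates** — it is the landed `helper_simplyConnectedRecognition` (conformal domination with constant `1.47`:
`λ(Φ(ι P)) ≤ 1.47 λ_cyl < 4/e = λ(S² × ℝ²)`, then Cor. 1.5 (b) for the simply connected `P`).  The certificates are the
tree's computational `certMid_all` (= the line's `stub_certMid`, landed with `Lean.ofReduceBool`); they stay a hypothesis
here so that this file keeps standard axioms. [cite: ChodoshMantoulidisSchulze2025, Cor. 1.5 (b) and Cor. 1.22 (b) (n = 4)] -/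
theorem nearSliceRecognition_of_cor15b
    (hb : Literature.Geometry.Riemannian.ChodoshMantoulidisSchulze2025_cor15b_four)
    (hmid : ∀ T : ℝ, 1 / 100 ≤ T → T ≤ 10 → ∃ (n : ℕ) (σ τ w : Fin n → ℝ) (c : ℝ), (∀ j, 0 < τ j) ∧ (∀ j, 0 ≤ w j) ∧ 0 ≤ c ∧ (∑ j, w j) + c ≤ 147 / 100 ∧ ∀ u s : ℝ, -1 ≤ s → s ≤ 1 → (8 * Real.pi ^ 2 / 3) * ((4 * Real.pi * T) ^ 2)⁻¹ * Real.exp (4 * u) * Real.exp (-(Real.exp (2 * u) - 2 * Real.exp u * s + 1) / (4 * T)) ≤ (∑ j, w j * (Literature.Geometry.Riemannian.SphericalCylinderEntropy.zonal (τ j) s * Real.exp (-(u - σ j) ^ 2 / (4 * τ j)))) + c) :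
    ∃ ε : ℝ, 0 < ε ∧ ∀ (P : Type) [TopologicalSpace P] [T2Space P] [SecondCountableTopology P] [ChartedSpace (EuclideanSpace ℝ (Fin 4)) P] [IsManifold (𝓡 4) ∞ P] [CompactSpace P] [ConnectedSpace P], SimplyConnectedSpace P → ∀ ι : P → EuclideanSpace ℝ (Fin 6), Manifold.IsSmoothEmbedding (𝓡 4) (𝓡 6) ∞ ι → (∀ x, ∑ i : Fin 5, ι x (Fin.castSucc i) ^ 2 = 1) → Literature.Geometry.Riemannian.SphericalCylinderEntropy.cylEntropy (Set.range ι) < ENNReal.ofReal (1 + ε) → Nonempty (P ≃ₘ⟮𝓡 4, 𝓡 4⟯ Metric.sphere (0 : EuclideanSpace ℝ (Fin 5)) 1) :=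
  helper_simplyConnectedRecognition hb hmid

/-- **`NearSliceRecognition` strengthens the route's rank-3 crux `SliceIsolation`** (stmt-SmoothPoincare4-7632): a homotopy
4-sphere is compact, connected and simply connected, and the items' `⨆` is the tree's `cylEntropy` by `rfl`; the separation
hypothesis of `SliceIsolation` is not needed. [folklore] -/
theorem sliceIsolation_of_nearSliceRecognition
    (hX₂ : ∃ ε : ℝ, 0 < ε ∧ ∀ (P : Type) [TopologicalSpace P] [T2Space P] [SecondCountableTopology P] [ChartedSpace (EuclideanSpace ℝ (Fin 4)) P] [IsManifold (𝓡 4) ∞ P] [CompactSpace P] [ConnectedSpace P], SimplyConnectedSpace P → ∀ ι : P → EuclideanSpace ℝ (Fin 6), Manifold.IsSmoothEmbedding (𝓡 4) (𝓡 6) ∞ ι → (∀ x, ∑ i : Fin 5, ι x (Fin.castSucc i) ^ 2 = 1) → Literature.Geometry.Riemannian.SphericalCylinderEntropy.cylEntropy (Set.range ι) < ENNReal.ofReal (1 + ε) → Nonempty (P ≃ₘ⟮𝓡 4, 𝓡 4⟯ Metric.sphere (0 : EuclideanSpace ℝ (Fin 5)) 1)) :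
    SliceIsolation := by
  obtain ⟨ε, hε, hrec⟩ := hX₂
  refine ⟨ε, hε, ?_⟩
  intro M _ _ _ _ _ e ι hι hN _hsep hent
  haveI : CompactSpace M := compactSpace_of_homotopyEquiv_sphere_four_holds M e
  haveI : PathConnectedSpace M := by
    haveI := pathConnectedSpace_sphere_four
    exact pathConnectedSpace_of_homotopyEquiv e
  exact hrec M (simplyConnectedSpace_of_homotopyEquiv_sphere_four simplyConnectedSpace_sphere_four_holds M e) ι hι hN hent

/-- **Immortal leaves are recognised by `NearSliceRecognition` and the PROVED immortal half**: along an immortal thin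
end-separating smooth flow of a compact connected simply connected carrier, the item `ImmortalAreaToFloor`
(stmt-SmoothPoincare4-17197, landed as `KillingFlux.areaToFloor`, p144604), Hamilton's monotonicity (`stub_hamiltonMonotonicity`,
landed) and the relaxation glue (`stub_relaxationOfAreaToFloor`, landed) give a late slice with `λ_cyl < 1 + ε`, which
`NearSliceRecognition` recognises.  This is exactly the hypothesis `hrec` of `helper_cylNeckSurgeryTopology`.
[cite: Hamilton1993, Thm. 4.1] -/
theorem immortalLeafRecognition_of_nearSliceRecognition
    (hX₂ : ∃ ε : ℝ, 0 < ε ∧ ∀ (P : Type) [TopologicalSpace P] [T2Space P] [SecondCountableTopology P] [ChartedSpace (EuclideanSpace ℝ (Fin 4)) P] [IsManifold (𝓡 4) ∞ P] [CompactSpace P] [ConnectedSpace P], SimplyConnectedSpace P → ∀ ι : P → EuclideanSpace ℝ (Fin 6), Manifold.IsSmoothEmbedding (𝓡 4) (𝓡 6) ∞ ι → (∀ x, ∑ i : Fin 5, ι x (Fin.castSucc i) ^ 2 = 1) → Literature.Geometry.Riemannian.SphericalCylinderEntropy.cylEntropy (Set.range ι) < ENNReal.ofReal (1 + ε) → Nonempty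 (P ≃ₘ⟮𝓡 4, 𝓡 4⟯ Metric.sphere (0 : EuclideanSpace ℝ (Fin 5)) 1)) :
    ∀ (P : Type) [TopologicalSpace P] [T2Space P] [SecondCountableTopology P] [ChartedSpace (EuclideanSpace ℝ (Fin 4)) P] [IsManifold (𝓡 4) ∞ P] [CompactSpace P] [ConnectedSpace P], SimplyConnectedSpace P → ∀ (F : ℝ → P → EuclideanSpace ℝ (Fin 6)) (ν : ℝ → P → EuclideanSpace ℝ (Fin 6)) (T : ℝ), Summit.SmoothPoincare4.SmoothPoincare4.Cruxes.CylinderRungTwo.KillingFlux.IsCylinderMCF P F ν T → (∀ t, T ≤ t → Summit.SmoothPoincare4.SmoothPoincare4.Cruxes.CylinderRungTwo.KillingFlux.SeparatesEnds (Set.range (F t))) → (∀ t, T ≤ t → Literature.Geometry.Riemannian.SphericalCylinderEntropy.cylEntropy (Set.range (F t)) < 2) → Nonempty (P ≃ₘ⟮𝓡 4, 𝓡 4⟯ Metric.sphere (0 : EuclideanSpace ℝ (Fin 5)) 1) := by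
  obtain ⟨ε, hε, hrec⟩ := hX₂
  intro P _ _ _ _ _ _ _ hsc F ν T hflow hsep hent
  obtain ⟨t₀, hTt₀, hsmall⟩ :=
    stub_relaxationOfAreaToFloor stub_hamiltonMonotonicity areaToFloor P F ν T hflow hsep hent ε hε
  exact hrec P hsc (F t₀) (hflow.isSmoothEmbedding t₀ hTt₀) (hflow.mem_cyl t₀ hTt₀) (hsmall t₀ le_rfl)

/-! ### The assembly -/

/-- **THE SPLIT OF THE CRUX: `CylinderSurgeryResolution → NearSliceRecognition → CylinderRungTwo`.**  Given a homotopy 4-sphere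
`M` with a thin end-separating cross-section embedding `ι` into `N`: `M` is compact, connected and simply connected
(tree); the first piece, instantiated at the inductive predicate (`resolvable_of_leastPredicate`), resolves a slice of `M` by a
mean curvature flow with neck surgery in `N`; immortal leaves are standard by the second piece and the proved immortal half
(`immortalLeafRecognition_of_nearSliceRecognition`); Daniels-Holgate's backward induction over the surgery tree and
Kervaire–Milnor (`helper_cylNeckSurgeryTopology`) give `M ≅ S⁴`.  The route decl's separation / entropy hypotheses are
`SeparatesEnds` / `cylEntropy` by `rfl`. [cite: DanielsHolgate2022, Thm. 1.3 and proof of Thm. 6.4]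
[cite: KervaireMilnor1963, §2, Lemma 2.1] -/
theorem CylinderRungTwo_of_subs
    (hX₁ : haveI : (Literature.Geometry.Riemannian.euclideanMetric (EuclideanSpace ℝ (Fin 6))).HasLeviCivita := Literature.Geometry.Riemannian.instHasLeviCivitaEuclideanMetric; haveI : Fact (Module.finrank ℝ (EuclideanSpace ℝ (Fin 4)) = 3 + 1) := ⟨finrank_euclideanSpace_fin⟩; ∀ (M : Type) [TopologicalSpace M] [T2Space M] [SecondCountableTopology M] [ChartedSpace (EuclideanSpace ℝ (Fin 4)) M] [IsManifold (𝓡 4) ∞ M] [CompactSpace M] [ConnectedSpace M] (ι : M → EuclideanSpace ℝ (Fin 6)), Manifold.IsSmoothEmbedding (𝓡 4) (𝓡 6) ∞ ι → (∀ x, ∑ i : Fin 5, ι x (Fin.castSucc i) ^ 2 = 1) → Summit.SmoothPoincare4.SmoothPoincare4.Cruxes.CylinderRungTwo.KillingFlux.SeparatesEnds (Set.range ι) → Literature.Geometry.Riemannian.SphericalCylinderEntropy.cylEntropy (Set.range ι) < ENNReal.ofReal (4 / Real.exp 1) → ∃ κ : M → EuclideanSpace ℝ (Fin 6), ∀ Q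 : (∀ (P : Type) [TopologicalSpace P] [ChartedSpace (EuclideanSpace ℝ (Fin 4)) P], (P → EuclideanSpace ℝ (Fin 6)) → Prop), (∀ (P : Type) [TopologicalSpace P] [ChartedSpace (EuclideanSpace ℝ (Fin 4)) P], Literature.Geometry.Riemannian.IsMCFDiscardedComponent P → ∀ κ' : P → EuclideanSpace ℝ (Fin 6), Q P κ') → (∀ (P : Type) [TopologicalSpace P] [T2Space P] [ChartedSpace (EuclideanSpace ℝ (Fin 4)) P] [IsManifold (𝓡 4) ∞ P] (F ν : ℝ → P → EuclideanSpace ℝ (Fin 6)) (T₀ T₁ : ℝ), T₀ < T₁ → (∃ U : Set ℝ, IsOpen U ∧ Set.Icc T₀ T₁ ⊆ U ∧ ContMDiffOn (𝓘(ℝ, ℝ).prod (𝓡 4)) (𝓡 6) ∞ (fun q : ℝ × P => F q.1 q.2) (U ×ˢ Set.univ)) → (∀ t ∈ Set.Icc T₀ T₁, Manifold.IsSmoothEmbedding (𝓡 4) (𝓡 6) ∞ (F t)) → (∀ t ∈ Set.Icc T₀ T₁, ∀ x, ∑ i : Fin 5, F t x (Fin.castSucc i) ^ 2 = 1) → ∀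 himm : (∀ t ∈ Set.Icc T₀ T₁, (Literature.Geometry.Riemannian.euclideanMetric (EuclideanSpace ℝ (Fin 6))).IsSpacelikeImmersion (𝓡 4) (F t)), (∀ t ∈ Set.Icc T₀ T₁, (Literature.Geometry.Riemannian.euclideanMetric (EuclideanSpace ℝ (Fin 6))).IsUnitNormal (𝓡 4) (F t) (ν t) 1) → (∀ t ∈ Set.Icc T₀ T₁, ∀ x, ∑ i : Fin 5, ν t x (Fin.castSucc i) * F t x (Fin.castSucc i) = 0) → (∀ t ∈ Set.Icc T₀ T₁, ContMDiff (𝓡 4) (𝓡 6) ∞ (ν t)) → (∀ t (ht : t ∈ Set.Icc T₀ T₁) (x : P), mfderiv 𝓘(ℝ, ℝ) (𝓡 6) (fun s => F s x) t (1 : ℝ) = -((Literature.Geometry.Riemannian.euclideanMetric (EuclideanSpace ℝ (Fin 6))).meanCurvature (F t) Literature.Geometry.Lorentzian.PseudoRiemannianMetric.contMDiff_pullbackBilin_holds (himm t ht) (ν t) x) • ν t x) → Q P (F T₁) → Q P (F T₀)) → (∀ (P P' : Type) [TopologicalSpace P] [ChartedSpace (EuclideanSpace ℝ (Fin 4)) P]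 [TopologicalSpace P'] [ChartedSpace (EuclideanSpace ℝ (Fin 4)) P'] [IsManifold (𝓡 4) ∞ P'] (κ' : P → EuclideanSpace ℝ (Fin 6)) (e : P ≃ₘ⟮𝓡 4, 𝓡 4⟯ P'), Q P κ' → Q P' (κ' ∘ e.symm)) → (∀ (P : Type) [TopologicalSpace P] [T2Space P] [ChartedSpace (EuclideanSpace ℝ (Fin 4)) P] [IsManifold (𝓡 4) ∞ P] (κ' : P → EuclideanSpace ℝ (Fin 6)) (ψ : (Metric.sphere (0 : EuclideanSpace ℝ (Fin 4)) 1) × ℝ → P) (D₁ : Literature.Topology.FourManifolds.NeckCapData 3 ψ) (D₂ : Literature.Topology.FourManifolds.NeckCapData 3 (fun q : (Metric.sphere (0 : EuclideanSpace ℝ (Fin 4)) 1) × ℝ => ψ (q.1, -q.2))), Disjoint (D₁.side : Set P) D₂.side → (∀ p : P, p ∉ D₁.side → p ∉ D₂.side → ∃ θ : Metric.sphere (0 : EuclideanSpace ℝ (Fin 4)) 1, ψ (θ, 0) = p) → ∀ (κ₁ : D₁.Capped → EuclideanSpace ℝ (Fin 6)) (κ₂ : D₂.Capped → EuclideanSpace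 ℝ (Fin 6)), Q D₁.Capped κ₁ → Q D₂.Capped κ₂ → Q P κ') → (∀ (P : Type) [TopologicalSpace P] [T2Space P] [ChartedSpace (EuclideanSpace ℝ (Fin 4)) P] [IsManifold (𝓡 4) ∞ P] (κ' : P → EuclideanSpace ℝ (Fin 6)) (ψ : (Metric.sphere (0 : EuclideanSpace ℝ (Fin 4)) 1) × ℝ → P) (hψ : Manifold.IsSmoothEmbedding ((𝓡 3).prod 𝓘(ℝ, ℝ)) (𝓡 4) ∞ ψ) (hψo : IsOpen (Set.range ψ)), IsPreconnected (ψ '' (Set.univ ×ˢ ({0} : Set ℝ)))ᶜ → ∀ κ'' : Literature.Topology.FourManifolds.DoubleCap.M hψ hψo → EuclideanSpace ℝ (Fin 6), Q (Literature.Topology.FourManifolds.DoubleCap.M hψ hψo) κ'' → Q P κ') → (∀ (P : Type) [TopologicalSpace P] [T2Space P] [SecondCountableTopology P] [ChartedSpace (EuclideanSpace ℝ (Fin 4)) P] [IsManifold (𝓡 4) ∞ P] [CompactSpace P] [ConnectedSpace P] (F ν : ℝ → P → EuclideanSpace ℝ (Fin 6)) (T : ℝ), Summit.SmoothPoincare4.SmoothPoincare4.Cruxes.CylinderRungTwo.KillingFlux.IsCylinderMCF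 P F ν T → (∀ t, T ≤ t → Summit.SmoothPoincare4.SmoothPoincare4.Cruxes.CylinderRungTwo.KillingFlux.SeparatesEnds (Set.range (F t))) → (∀ t, T ≤ t → Literature.Geometry.Riemannian.SphericalCylinderEntropy.cylEntropy (Set.range (F t)) < 2) → Q P (F T)) → Q M κ)
    (hX₂ : ∃ ε : ℝ, 0 < ε ∧ ∀ (P : Type) [TopologicalSpace P] [T2Space P] [SecondCountableTopology P] [ChartedSpace (EuclideanSpace ℝ (Fin 4)) P] [IsManifold (𝓡 4) ∞ P] [CompactSpace P] [ConnectedSpace P], SimplyConnectedSpace P → ∀ ι : P → EuclideanSpace ℝ (Fin 6), Manifold.IsSmoothEmbedding (𝓡 4) (𝓡 6) ∞ ι → (∀ x, ∑ i : Fin 5, ι x (Fin.castSucc i) ^ 2 = 1) → Literature.Geometry.Riemannian.SphericalCylinderEntropy.cylEntropy (Set.range ι) < ENNReal.ofReal (1 + ε) → Nonempty (P ≃ₘ⟮𝓡 4, 𝓡 4⟯ Metric.sphere (0 : EuclideanSpace ℝ (Fin 5)) 1)) :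
    Summit.SmoothPoincare4.SmoothPoincare4.Theses.CylinderEntropy.CylinderRungTwo := by
  intro M _ _ _ _ _ e ι hι hN hsep hent
  haveI : CompactSpace M := compactSpace_of_homotopyEquiv_sphere_four_holds M e
  haveI : PathConnectedSpace M := by
    haveI := pathConnectedSpace_sphere_four
    exact pathConnectedSpace_of_homotopyEquiv e
  have hsc : SimplyConnectedSpace M :=
    simplyConnectedSpace_of_homotopyEquiv_sphere_four simplyConnectedSpace_sphere_four_holds M e
  obtain ⟨κ, hκ⟩ := hX₁ M ι hι hN hsep hent
  exact helper_cylNeckSurgeryTopology (immortalLeafRecognition_of_nearSliceRecognition hX₂) M κ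
    (resolvable_of_leastPredicate hκ) hsc

/-- The same, with the pieces conjoined: **`CylinderSurgeryResolution ∧ NearSliceRecognition → CylinderRungTwo`**. [folklore] -/
theorem CylinderRungTwo_of_subs_and
    (h : (haveI : (Literature.Geometry.Riemannian.euclideanMetric (EuclideanSpace ℝ (Fin 6))).HasLeviCivita := Literature.Geometry.Riemannian.instHasLeviCivitaEuclideanMetric; haveI : Fact (Module.finrank ℝ (EuclideanSpace ℝ (Fin 4)) = 3 + 1) := ⟨finrank_euclideanSpace_fin⟩; ∀ (M : Type) [TopologicalSpace M] [T2Space M] [SecondCountableTopology M] [ChartedSpace (EuclideanSpace ℝ (Fin 4)) M] [IsManifold (𝓡 4) ∞ M] [CompactSpace M] [ConnectedSpace M] (ι : M → EuclideanSpace ℝ (Fin 6)), Manifold.IsSmoothEmbedding (𝓡 4) (𝓡 6) ∞ ι → (∀ x, ∑ i : Fin 5, ι x (Fin.castSucc i) ^ 2 = 1) → Summit.SmoothPoincare4.SmoothPoincare4.Cruxes.CylinderRungTwo.KillingFlux.SeparatesEnds (Set.range ι) → Literature.Geometry.Riemannian.SphericalCylinderEntropy.cylEntropy (Set.range ι) <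 ENNReal.ofReal (4 / Real.exp 1) → ∃ κ : M → EuclideanSpace ℝ (Fin 6), ∀ Q : (∀ (P : Type) [TopologicalSpace P] [ChartedSpace (EuclideanSpace ℝ (Fin 4)) P], (P → EuclideanSpace ℝ (Fin 6)) → Prop), (∀ (P : Type) [TopologicalSpace P] [ChartedSpace (EuclideanSpace ℝ (Fin 4)) P], Literature.Geometry.Riemannian.IsMCFDiscardedComponent P → ∀ κ' : P → EuclideanSpace ℝ (Fin 6), Q P κ') → (∀ (P : Type) [TopologicalSpace P] [T2Space P] [ChartedSpace (EuclideanSpace ℝ (Fin 4)) P] [IsManifold (𝓡 4) ∞ P] (F ν : ℝ → P → EuclideanSpace ℝ (Fin 6)) (T₀ T₁ : ℝ), T₀ < T₁ → (∃ U : Set ℝ, IsOpen U ∧ Set.Icc T₀ T₁ ⊆ U ∧ ContMDiffOn (𝓘(ℝ, ℝ).prod (𝓡 4)) (𝓡 6) ∞ (fun q : ℝ × P => F q.1 q.2) (U ×ˢ Set.univ)) → (∀ t ∈ Set.Icc T₀ T₁, Manifold.IsSmoothEmbedding (𝓡 4) (𝓡 6) ∞ (F t)) → (∀ t ∈ Set.Icc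 T₀ T₁, ∀ x, ∑ i : Fin 5, F t x (Fin.castSucc i) ^ 2 = 1) → ∀ himm : (∀ t ∈ Set.Icc T₀ T₁, (Literature.Geometry.Riemannian.euclideanMetric (EuclideanSpace ℝ (Fin 6))).IsSpacelikeImmersion (𝓡 4) (F t)), (∀ t ∈ Set.Icc T₀ T₁, (Literature.Geometry.Riemannian.euclideanMetric (EuclideanSpace ℝ (Fin 6))).IsUnitNormal (𝓡 4) (F t) (ν t) 1) → (∀ t ∈ Set.Icc T₀ T₁, ∀ x, ∑ i : Fin 5, ν t x (Fin.castSucc i) * F t x (Fin.castSucc i) = 0) → (∀ t ∈ Set.Icc T₀ T₁, ContMDiff (𝓡 4) (𝓡 6) ∞ (ν t)) → (∀ t (ht : t ∈ Set.Icc T₀ T₁) (x : P), mfderiv 𝓘(ℝ, ℝ) (𝓡 6) (fun s => F s x) t (1 : ℝ) = -((Literature.Geometry.Riemannian.euclideanMetric (EuclideanSpace ℝ (Fin 6))).meanCurvature (F t) Literature.Geometry.Lorentzian.PseudoRiemannianMetric.contMDiff_pullbackBilin_holds (himm t ht) (ν t) x) • ν t x) → Q P (F T₁) → Q P (F T₀))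 → (∀ (P P' : Type) [TopologicalSpace P] [ChartedSpace (EuclideanSpace ℝ (Fin 4)) P] [TopologicalSpace P'] [ChartedSpace (EuclideanSpace ℝ (Fin 4)) P'] [IsManifold (𝓡 4) ∞ P'] (κ' : P → EuclideanSpace ℝ (Fin 6)) (e : P ≃ₘ⟮𝓡 4, 𝓡 4⟯ P'), Q P κ' → Q P' (κ' ∘ e.symm)) → (∀ (P : Type) [TopologicalSpace P] [T2Space P] [ChartedSpace (EuclideanSpace ℝ (Fin 4)) P] [IsManifold (𝓡 4) ∞ P] (κ' : P → EuclideanSpace ℝ (Fin 6)) (ψ : (Metric.sphere (0 : EuclideanSpace ℝ (Fin 4)) 1) × ℝ → P) (D₁ : Literature.Topology.FourManifolds.NeckCapData 3 ψ) (D₂ : Literature.Topology.FourManifolds.NeckCapData 3 (fun q : (Metric.sphere (0 : EuclideanSpace ℝ (Fin 4)) 1) × ℝ => ψ (q.1, -q.2))), Disjoint (D₁.side : Set P) D₂.side → (∀ p : P, p ∉ D₁.side → p ∉ D₂.side → ∃ θ : Metric.sphere (0 : EuclideanSpace ℝ (Fin 4)) 1, ψ (θ, 0) = p) → ∀ (κ₁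 : D₁.Capped → EuclideanSpace ℝ (Fin 6)) (κ₂ : D₂.Capped → EuclideanSpace ℝ (Fin 6)), Q D₁.Capped κ₁ → Q D₂.Capped κ₂ → Q P κ') → (∀ (P : Type) [TopologicalSpace P] [T2Space P] [ChartedSpace (EuclideanSpace ℝ (Fin 4)) P] [IsManifold (𝓡 4) ∞ P] (κ' : P → EuclideanSpace ℝ (Fin 6)) (ψ : (Metric.sphere (0 : EuclideanSpace ℝ (Fin 4)) 1) × ℝ → P) (hψ : Manifold.IsSmoothEmbedding ((𝓡 3).prod 𝓘(ℝ, ℝ)) (𝓡 4) ∞ ψ) (hψo : IsOpen (Set.range ψ)), IsPreconnected (ψ '' (Set.univ ×ˢ ({0} : Set ℝ)))ᶜ → ∀ κ'' : Literature.Topology.FourManifolds.DoubleCap.M hψ hψo → EuclideanSpace ℝ (Fin 6), Q (Literature.Topology.FourManifolds.DoubleCap.M hψ hψo) κ'' → Q P κ') → (∀ (P : Type) [TopologicalSpace P] [T2Space P] [SecondCountableTopology P] [ChartedSpace (EuclideanSpace ℝ (Fin 4)) P] [IsManifold (𝓡 4) ∞ P] [CompactSpace P] [ConnectedSpace P] (F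 ν : ℝ → P → EuclideanSpace ℝ (Fin 6)) (T : ℝ), Summit.SmoothPoincare4.SmoothPoincare4.Cruxes.CylinderRungTwo.KillingFlux.IsCylinderMCF P F ν T → (∀ t, T ≤ t → Summit.SmoothPoincare4.SmoothPoincare4.Cruxes.CylinderRungTwo.KillingFlux.SeparatesEnds (Set.range (F t))) → (∀ t, T ≤ t → Literature.Geometry.Riemannian.SphericalCylinderEntropy.cylEntropy (Set.range (F t)) < 2) → Q P (F T)) → Q M κ) ∧ (∃ ε : ℝ, 0 < ε ∧ ∀ (P : Type) [TopologicalSpace P] [T2Space P] [SecondCountableTopology P] [ChartedSpace (EuclideanSpace ℝ (Fin 4)) P] [IsManifold (𝓡 4) ∞ P] [CompactSpace P] [ConnectedSpace P], SimplyConnectedSpace P → ∀ ι : P → EuclideanSpace ℝ (Fin 6), Manifold.IsSmoothEmbedding (𝓡 4) (𝓡 6) ∞ ι → (∀ x, ∑ i : Fin 5, ι x (Fin.castSucc i) ^ 2 = 1) → Literature.Geometry.Riemannian.SphericalCylinderEntropy.cylEntropy (Set.range ι) < ENNReal.ofReal (1 + ε) → Nonempty (P ≃ₘ⟮𝓡 4,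 𝓡 4⟯ Metric.sphere (0 : EuclideanSpace ℝ (Fin 5)) 1))) :
    Summit.SmoothPoincare4.SmoothPoincare4.Theses.CylinderEntropy.CylinderRungTwo :=
  CylinderRungTwo_of_subs h.1 h.2

end Summit.SmoothPoincare4.SmoothPoincare4.Theorems.CylinderRungTwoSplit

end
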